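import Mathlib
import Literature.NumberTheory.LFunctions.Zhang2022.Section13U007b
import Literature.NumberTheory.LFunctions.Zhang2022.Section7Eq75Majorants
import Literature.NumberTheory.LFunctions.Zhang2022.Section17MeanSquareMajorant
import Literature.NumberTheory.LFunctions.Zhang2022.Section15Bcoef
import HarnessLib

/-!
# Zhang (2022) §13 p. 75, the estimate (13.11) «𝓔 = o(𝔓)»: tools for the LOSS-FREE mean squares
# (Lemma 3.3, first assertion) of the Dirichlet-polynomial factors of `E₁*(ρ,ψ)|B(ρ,ψ)|`

Topic `Literature/NumberTheory/LFunctions/Zhang2022` (Landau–Siegel audit tree; verdict-neutral).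
Y. Zhang, *Discrete mean estimates and the Landau–Siegel zero*, arXiv:2211.02515v1 (2022)
[Zhang2022LandauSiegel], §13 p. 75, tex L3806–3817: "Combining (2.34), Cauchy's inequality,
Proposition 7.1, Lemma 5.9, 6.1 and 3.3, we can verify that `𝓔 = o(𝔓)` (13.11)" — a verification NOT
carried out in print (plan/GAP-LEDGER G-L3t6-3; lane ZHANG-L WP14, leaf `Skeleton.Eq1311Rel c′ c₀`).
**An unrefereed manuscript under adjudication; nothing here asserts its Theorems 1–2.**

The cell's route for (13.11) (WP14 split, zl-w14-p6 / zl-w14-p5): after Cauchy–Schwarz on the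
non-negative weights `w(ρ,ψ) = |L(ρ+β₁,ψ)/L′(ρ,ψ)|ω(ρ)` and the (2.34)-conversion of each
`ΣΣ_ρ w|F(ρ)|²` into integrals over `𝒥(±α)` (Lemma 5.9), every term of `𝓔` reduces to MEAN SQUARES
`Σ_{ψ} |F(s,ψ)|²` on the lines `Re s = ½ ± α`, where `F` is one `L`-factor ALONE or the product of
`B(s,ψ)` (length `< PT⁻⁷` by (15.2)) with a SHORT factor (`N(s+β_j,ψ)`, length `2T²`; the `E₁`-polynomial
`Σ_{n<T³}ψ(n)n^{−w}`). All these have length `≤ P`, so the FIRST assertion of Lemma 3.3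
(`Skeleton.lemma33a_sum_le`: `≤ 𝔓·Σ|c(n)|²n^{−2σ}`, constant `1`) applies — with no loss against
`#Ψ ≍ 𝔓 ≍ P²𝓛⁻⁷⁷`, unlike the large sieve (second assertion, `≤ C·P²·Σ…`), which the prefactors of
the `E₁`-terms of `𝓔` (`𝓛⁻⁶⁸`) cannot afford. This file provides the bookkeeping:

* `rpow_neg_two_mul_le`, `sum_norm_sq_rpow_le` — the weights `n^{−2σ} ≤ e^{8π}n⁻¹` for
  `|σ − ½| ≤ 2α`, `n ≤ P²` (`α log P² = 2π`);
* `meanSq_floorP_le` / `meanSq_floorPsq_le` — Lemma 3.3 (i)/(ii) over any finite `T ⊆ Ψ` with the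
  weights removed: `≤ e^{8π}·𝔓·Σ_{n≤P}|c(n)|²/n`, resp. `≤ e^{8π}C₃₃·P²·Σ_{n≤P²}|c(n)|²/n`;
* `sum_Ico_eq_sum_Icc_trunc`, `dirPoly_mul_dirPoly_eq` — a truncated Dirichlet polynomial, and the
  PRODUCT of two of them with a completely multiplicative twist, as one polynomial over `1 ≤ k ≤ K` with
  (convolution) coefficients (`MeanSquareMajorant.seqConv`; generalises `Section7Eq75.sq_dirPoly_eq`);
* `dom_trunc_unimodular`, `dom_bcoef_chi` — the coefficient sequences are DOMINATED
  (`MeanSquareMajorant.Dom`) by the blocks `smoothIndLE y` (bounded, supported on `n ≤ y`) and `β·τ₂`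
  (`b ≪ τ₂`, (15.2), tree `Skeleton.norm_bcoef_le`);
* `sum_norm_seqConv_short_bcoef_sq_div_le`, `sum_norm_seqConv_short_short_sq_div_le`,
  `sum_norm_bcoef_chi_sq_div_le` — the logarithmic mean squares `Σ_{k≤X}|c(k)|²/k` of the coefficients of
  `(short)·B`, `(short)·(short)`, `B`: `≤ β²·majorantConst 9 6·(log X)⁴(log y)⁵`, `≤ majorantConst 4 2·(log y)⁴`,
  `≤ β²·majorantConst 4 4·(log X)⁴` — by the block calculus of `Section17MeanSquareMajorant`
  (`IsBlock.mul`, `dom_seqConv`, `sum_norm_sq_div_le_of_dom`): a factor supported on `n ≤ y`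
  contributes `log y` (here `y = T^{O(1)}`, `log y = O(𝓛^{1.1})`), not `log X = O(𝓛⁹)`.

Theorem-only (no definitions, no new named facts); nothing here is specific to Assumption (A).
WHAT THIS IS NOT: any claim about Theorems 1–2 of the manuscript or about Landau–Siegel zeros.

## References

* Y. Zhang, arXiv:2211.02515v1 (2022), §13 p. 75; §3 Lemma 3.3 p. 14; §15 (15.1)–(15.2) p. 79;
  §6 Lemma 6.1 p. 30. [cite: Zhang2022LandauSiegel, §13 (13.11) p.75]
-/

noncomputable section

open Complex Real Finset

namespace Literature.NumberTheory.LFunctions.Zhang2022.Typed.Section13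

open Skeleton MeanSquareMajorant Section7Eq75

/-! ## The weights `n^{−2σ}` near the critical line -/

/-- **`n^{−2σ} ≤ e^{8π}·n⁻¹`** for `1 ≤ n ≤ P²` and `|σ − ½| ≤ 2α` (`n^{1−2σ} ≤ (P²)^{4α} = e^{8π}`
since `α log P = π`). [cite: Zhang2022LandauSiegel, §2 (2.10); §13 p.75] -/
theorem rpow_neg_two_mul_le {D : ℕ} (hL : 1 ≤ ell D) {σ : ℝ} (hσ : |σ - 1 / 2| ≤ 2 * alpha D)
    {n : ℕ} (hn : 1 ≤ n) (hnP : (n : ℝ) ≤ bigP D ^ 2) :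
    (n : ℝ) ^ (-2 * σ) ≤ Real.exp (8 * π) * (n : ℝ)⁻¹ := by
  have hL0 : 0 < ell D := by linarith
  have hα : alpha D = π / ell D ^ 9 := by rw [alpha, bigP, Real.log_exp]
  have hP2 : bigP D ^ 2 = Real.exp (2 * ell D ^ 9) := by rw [bigP, ← Real.exp_nat_mul]; ring_nf
  have hP2_1 : 1 ≤ bigP D ^ 2 := by rw [hP2]; exact Real.one_le_exp (by positivity)
  have hn1 : (1 : ℝ) ≤ n := by exact_mod_cast hn
  have hn0 : (0 : ℝ) < n := by linarith
  have he : |-2 * σ + 1| ≤ 4 * alpha D := by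
    rw [show -2 * σ + 1 = -2 * (σ - 1 / 2) by ring, abs_mul, abs_neg, abs_two]; linarith
  have h1 : (n : ℝ) ^ (-2 * σ) = (n : ℝ) ^ (-2 * σ + 1) * (n : ℝ)⁻¹ := by
    rw [Real.rpow_add hn0, Real.rpow_one, mul_assoc, mul_inv_cancel₀ hn0.ne', mul_one]
  rw [h1]
  refine mul_le_mul_of_nonneg_right ?_ (inv_nonneg.mpr hn0.le)
  calc (n : ℝ) ^ (-2 * σ + 1) ≤ (n : ℝ) ^ |-2 * σ + 1| :=
        Real.rpow_le_rpow_of_exponent_le hn1 (le_abs_self _)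
    _ ≤ (bigP D ^ 2) ^ |-2 * σ + 1| := Real.rpow_le_rpow hn0.le hnP (abs_nonneg _)
    _ ≤ (bigP D ^ 2) ^ (4 * alpha D) := Real.rpow_le_rpow_of_exponent_le hP2_1 he
    _ = Real.exp (8 * π) := by
        rw [hP2, ← Real.exp_mul, hα]
        congr 1
        field_simp
        ring

/-- **The weighted coefficient sum**: `Σ_{n≤K} |c(n)|²n^{−2σ} ≤ e^{8π}Σ_{n≤K} |c(n)|²/n` for
`K ≤ P²`, `|σ − ½| ≤ 2α`. [cite: Zhang2022LandauSiegel, §13 p.75; §3 Lemma 3.3 p.14] -/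
theorem sum_norm_sq_rpow_le {D : ℕ} (hL : 1 ≤ ell D) {σ : ℝ} (hσ : |σ - 1 / 2| ≤ 2 * alpha D)
    {K : ℕ} (hK : (K : ℝ) ≤ bigP D ^ 2) (c : ℕ → ℂ) :
    ∑ n ∈ Icc 1 K, ‖c n‖ ^ 2 * (n : ℝ) ^ (-2 * σ) ≤
      Real.exp (8 * π) * ∑ n ∈ Icc 1 K, ‖c n‖ ^ 2 / n := by
  rw [Finset.mul_sum]
  refine Finset.sum_le_sum fun n hn => ?_
  obtain ⟨hn1, hnK⟩ := Finset.mem_Icc.mp hn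
  have hnP : (n : ℝ) ≤ bigP D ^ 2 := le_trans (by exact_mod_cast hnK) hK
  calc ‖c n‖ ^ 2 * (n : ℝ) ^ (-2 * σ) ≤ ‖c n‖ ^ 2 * (Real.exp (8 * π) * (n : ℝ)⁻¹) :=
        mul_le_mul_of_nonneg_left (rpow_neg_two_mul_le hL hσ hn1 hnP) (sq_nonneg _)
    _ = Real.exp (8 * π) * (‖c n‖ ^ 2 / n) := by rw [div_eq_mul_inv]; ring

/-- `⌊P⌋ ≤ P²` and `⌊P²⌋ ≤ P²` as real numbers (`P ≥ 1`). [cite: Zhang2022LandauSiegel, §2 (2.6)] -/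
theorem floor_bigP_le_sq (D : ℕ) :
    ((⌊bigP D⌋₊ : ℕ) : ℝ) ≤ bigP D ^ 2 ∧ ((⌊bigP D ^ 2⌋₊ : ℕ) : ℝ) ≤ bigP D ^ 2 := by
  have hP1 : 1 ≤ bigP D := Real.one_le_exp (pow_nonneg (Real.log_natCast_nonneg D) 9)
  have hP0 : 0 ≤ bigP D := by linarith
  refine ⟨(Nat.floor_le hP0).trans ?_, Nat.floor_le (by positivity)⟩
  calc bigP D = bigP D * 1 := (mul_one _).symm
    _ ≤ bigP D * bigP D := mul_le_mul_of_nonneg_left hP1 hP0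
    _ = bigP D ^ 2 := (sq _).symm

/-- **Lemma 3.3 (i) near the critical line** ("by the orthogonality relation"; tree
`Skeleton.lemma33a_sum_le`, implied constant `1`): for any finite `T ⊆ Ψ`, `|Re s − ½| ≤ 2α` and any
coefficients, `Σ_{ψ∈T} |Σ_{n≤P} c(n)ψ(n)n^{−s}|² ≤ e^{8π}·𝔓·Σ_{n≤P} |c(n)|²/n` — NO loss against
`#Ψ ≍ 𝔓`. [cite: Zhang2022LandauSiegel, §3 Lemma 3.3 p.14; §13 p.75] -/
theorem meanSq_floorP_le {D : ℕ} (hL : 1 ≤ ell D) (T : Finset (Chr D)) {s : ℂ}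
    (hs : |s.re - 1 / 2| ≤ 2 * alpha D) (c : ℕ → ℂ) :
    ∑ x ∈ T, ‖∑ n ∈ Icc 1 ⌊bigP D⌋₊, c n * x.ψ (n : ZMod x.p) * (n : ℂ) ^ (-s)‖ ^ 2
      ≤ Real.exp (8 * π) * frakP D * ∑ n ∈ Icc 1 ⌊bigP D⌋₊, ‖c n‖ ^ 2 / n := by
  have hP : 0 ≤ frakP D := by
    rw [frakP_eq_sum_primeWindow]; exact Finset.sum_nonneg fun p _ => Nat.cast_nonneg p
  calc _ ≤ frakP D * ∑ n ∈ Icc 1 ⌊bigP D⌋₊, ‖c n‖ ^ 2 * (n : ℝ) ^ (-2 * s.re) :=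
        lemma33a_sum_le T s c
    _ ≤ frakP D * (Real.exp (8 * π) * ∑ n ∈ Icc 1 ⌊bigP D⌋₊, ‖c n‖ ^ 2 / n) :=
        mul_le_mul_of_nonneg_left (sum_norm_sq_rpow_le hL hs (floor_bigP_le_sq D).1 c) hP
    _ = _ := by ring

/-- **Lemma 3.3 (ii) near the critical line** ("by the large sieve inequality"; tree
`Skeleton.lemma33b_sum_le`): `Σ_{ψ∈T} |Σ_{n≤P²} c(n)ψ(n)n^{−s}|² ≤ e^{8π}C₃₃·P²·Σ_{n≤P²} |c(n)|²/n`,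
`C₃₃ = 2 + 2(3 + (log 2)⁻⁶⁸)²`. [cite: Zhang2022LandauSiegel, §3 Lemma 3.3 p.14; §13 p.75] -/
theorem meanSq_floorPsq_le {D : ℕ} (hL : 1 ≤ ell D) (T : Finset (Chr D)) {s : ℂ}
    (hs : |s.re - 1 / 2| ≤ 2 * alpha D) (c : ℕ → ℂ) :
    ∑ x ∈ T, ‖∑ n ∈ Icc 1 ⌊bigP D ^ 2⌋₊, c n * x.ψ (n : ZMod x.p) * (n : ℂ) ^ (-s)‖ ^ 2
      ≤ Real.exp (8 * π) * ((2 + 2 * (3 + (Real.log 2 ^ 68)⁻¹) ^ 2) * bigP D ^ 2) *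
          ∑ n ∈ Icc 1 ⌊bigP D ^ 2⌋₊, ‖c n‖ ^ 2 / n := by
  have hC : 0 ≤ (2 + 2 * (3 + (Real.log 2 ^ 68)⁻¹) ^ 2) * bigP D ^ 2 :=
    mul_nonneg c33_nonneg (by positivity)
  calc _ ≤ (2 + 2 * (3 + (Real.log 2 ^ 68)⁻¹) ^ 2) * bigP D ^ 2 *
          ∑ n ∈ Icc 1 ⌊bigP D ^ 2⌋₊, ‖c n‖ ^ 2 * (n : ℝ) ^ (-2 * s.re) := lemma33b_sum_le T s c
    _ ≤ (2 + 2 * (3 + (Real.log 2 ^ 68)⁻¹) ^ 2) * bigP D ^ 2 *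
          (Real.exp (8 * π) * ∑ n ∈ Icc 1 ⌊bigP D ^ 2⌋₊, ‖c n‖ ^ 2 / n) :=
        mul_le_mul_of_nonneg_left (sum_norm_sq_rpow_le hL hs (floor_bigP_le_sq D).2 c) hC
    _ = _ := by ring

/-! ## Truncated Dirichlet polynomials and their products as polynomials over `1 ≤ k ≤ K` -/

/-- A truncated Dirichlet polynomial `Σ_{1≤n<N} c(n)θ(n)n^{−w}` written over `1 ≤ n ≤ K` (`K ≥ N − 1`)
with the truncated coefficients `c·1_{n<N}`. [cite: Zhang2022LandauSiegel, §3 Lemma 3.3 p.14] -/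
theorem sum_Ico_eq_sum_Icc_trunc {N K : ℕ} (hK : N - 1 ≤ K) (c θ : ℕ → ℂ) (w : ℂ) :
    ∑ n ∈ Ico 1 N, c n * θ n * (n : ℂ) ^ (-w) =
      ∑ n ∈ Icc 1 K, (fun n => if n < N then c n else 0) n * θ n * (n : ℂ) ^ (-w) := by
  have hsub : Ico 1 N ⊆ Icc 1 K := fun n hn => by
    rw [Finset.mem_Ico] at hn
    rw [Finset.mem_Icc]
    exact ⟨hn.1, by omega⟩
  rw [← Finset.sum_subset hsub (f := fun n => (fun n => if n < N then c n else 0) n * θ n *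
      (n : ℂ) ^ (-w)) ?_]
  · refine Finset.sum_congr rfl fun n hn => ?_
    simp only [if_pos (Finset.mem_Ico.mp hn).2]
  · intro n hn hn'
    rw [Finset.mem_Icc] at hn
    rw [Finset.mem_Ico, not_and, not_lt] at hn'
    have : ¬ n < N := not_lt.mpr (hn' hn.1)
    simp only [if_neg this, zero_mul]

/-- **The product of two truncated Dirichlet polynomials with a completely multiplicative twist**
(`θ(mn) = θ(m)θ(n)`, e.g. `θ = ψ` or `ψχ`): for `(M−1)(N−1) ≤ K`,
`(Σ_{1≤m<M} u(m)θ(m)m^{−w})(Σ_{1≤n<N} v(n)θ(n)n^{−w}) = Σ_{1≤k≤K} (u′⋆v′)(k)θ(k)k^{−w}` with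
`u′ = u·1_{m<M}`, `v′ = v·1_{n<N}` (generalising `Section7Eq75.sq_dirPoly_eq`; used for `N(s+β_j,ψ)B(s,ψ)`,
the `E₁`-polynomial times `B`, and `N(s+β₂,ψ)N(s+β₃,ψ)`). [cite: Zhang2022LandauSiegel, §13 p.75; §15 (15.1)] -/
theorem dirPoly_mul_dirPoly_eq (M N K : ℕ) (hK : (M - 1) * (N - 1) ≤ K) (u v θ : ℕ → ℂ)
    (hθ : ∀ m n, θ (m * n) = θ m * θ n) (w : ℂ) :
    (∑ m ∈ Ico 1 M, u m * θ m * (m : ℂ) ^ (-w)) * (∑ n ∈ Ico 1 N, v n * θ n * (n : ℂ) ^ (-w)) =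
      ∑ k ∈ Icc 1 K, seqConv (fun n => if n < M then u n else 0) (fun n => if n < N then v n else 0) k
        * θ k * (k : ℂ) ^ (-w) := by
  classical
  set u' : ℕ → ℂ := fun n => if n < M then u n else 0 with hu'
  set v' : ℕ → ℂ := fun n => if n < N then v n else 0 with hv'
  set F : ℕ × ℕ → ℂ := fun x =>
    u' x.1 * v' x.2 * (θ (x.1 * x.2) * ((x.1 * x.2 : ℕ) : ℂ) ^ (-w)) with hF
  have hL : (∑ m ∈ Ico 1 M, u m * θ m * (m : ℂ) ^ (-w)) *
      (∑ n ∈ Ico 1 N, v n * θ n * (n : ℂ) ^ (-w)) = ∑ x ∈ Ico 1 M ×ˢ Ico 1 N, F x := by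
    rw [Finset.sum_mul_sum, Finset.sum_product]
    refine Finset.sum_congr rfl fun m hm => Finset.sum_congr rfl fun n hn => ?_
    have hm' : u' m = u m := by simp only [hu', if_pos (Finset.mem_Ico.1 hm).2]
    have hn' : v' n = v n := by simp only [hv', if_pos (Finset.mem_Ico.1 hn).2]
    simp only [hF, hθ, Nat.cast_mul, Complex.natCast_mul_natCast_cpow, hm', hn']
    ring
  have hdisj : (↑(Icc 1 K) : Set ℕ).PairwiseDisjoint Nat.divisorsAntidiagonal := by
    intro k₁ _ k₂ _ hne
    rw [Function.onFun, Finset.disjoint_left]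
    intro x h₁ h₂
    exact hne ((Nat.mem_divisorsAntidiagonal.1 h₁).1.symm.trans (Nat.mem_divisorsAntidiagonal.1 h₂).1)
  have hR : ∑ k ∈ Icc 1 K, seqConv u' v' k * θ k * (k : ℂ) ^ (-w) =
      ∑ x ∈ (Icc 1 K).biUnion Nat.divisorsAntidiagonal, F x := by
    rw [Finset.sum_biUnion hdisj]
    refine Finset.sum_congr rfl fun k _ => ?_
    rw [seqConv, Finset.sum_mul, Finset.sum_mul]
    refine Finset.sum_congr rfl fun x hx => ?_
    obtain ⟨hxk, -⟩ := Nat.mem_divisorsAntidiagonal.1 hx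
    simp only [hF, hxk]
    ring
  have hsub : Ico 1 M ×ˢ Ico 1 N ⊆ (Icc 1 K).biUnion Nat.divisorsAntidiagonal := by
    intro x hx
    rw [Finset.mem_product, Finset.mem_Ico, Finset.mem_Ico] at hx
    rw [Finset.mem_biUnion]
    have hne : x.1 * x.2 ≠ 0 :=
      Nat.mul_ne_zero (Nat.one_le_iff_ne_zero.1 hx.1.1) (Nat.one_le_iff_ne_zero.1 hx.2.1)
    refine ⟨x.1 * x.2, Finset.mem_Icc.2 ⟨Nat.one_le_iff_ne_zero.2 hne, ?_⟩,
      Nat.mem_divisorsAntidiagonal.2 ⟨rfl, hne⟩⟩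
    exact le_trans (Nat.mul_le_mul (Nat.le_sub_one_of_lt hx.1.2) (Nat.le_sub_one_of_lt hx.2.2)) hK
  have hzero : ∀ x ∈ (Icc 1 K).biUnion Nat.divisorsAntidiagonal,
      x ∉ Ico 1 M ×ˢ Ico 1 N → F x = 0 := by
    intro x hx hx'
    rw [Finset.mem_biUnion] at hx
    obtain ⟨k, _, hk⟩ := hx
    have hk' := Nat.mem_divisorsAntidiagonal.1 hk
    have h1 : x.1 ≠ 0 := fun h => hk'.2 (by rw [← hk'.1, h, zero_mul])
    have h2 : x.2 ≠ 0 := fun h => hk'.2 (by rw [← hk'.1, h, mul_zero])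
    rw [Finset.mem_product, Finset.mem_Ico, Finset.mem_Ico, not_and_or] at hx'
    rw [hF]
    rcases hx' with h | h
    · have : ¬ x.1 < M := fun h' => h ⟨Nat.one_le_iff_ne_zero.2 h1, h'⟩
      simp [hu', this]
    · have : ¬ x.2 < N := fun h' => h ⟨Nat.one_le_iff_ne_zero.2 h2, h'⟩
      simp [hv', this]
  rw [hL, hR]
  exact Finset.sum_subset hsub hzero

/-! ## Domination of the coefficient sequences by the blocks `smoothIndLE y` and `τ₂` -/

/-- `|n^{−β}| = 1` for `n ≥ 1` and `Re β = 0` (the shifts `β_j` of (2.13) and the `iv` of `E₁` are purely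
imaginary). [cite: Zhang2022LandauSiegel, §2 (2.13)] -/
theorem norm_natCast_cpow_neg_of_re_zero {n : ℕ} (hn : n ≠ 0) {β : ℂ} (hβ : β.re = 0) :
    ‖(n : ℂ) ^ (-β)‖ = 1 := by
  rw [Complex.norm_natCast_cpow_of_pos (Nat.pos_of_ne_zero hn), Complex.neg_re, hβ, neg_zero,
    Real.rpow_zero]

/-- **A bounded sequence truncated to `n < y` is dominated by the `y`-smooth indicator**:
`|g(n)| ≤ 1`, `Re β = 0` ⇒ `(g(n)n^{−β})·1_{n<y} ≪ 1·smoothIndLE y` (used for the coefficients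
`g*(T²/n)n^{−β_j}` of `N(s+β_j,ψ)` and `n^{−β_j−iv}` of the `E₁`-polynomial). [cite: Zhang2022LandauSiegel, §6 Lemma 6.1 p.30] -/
theorem dom_trunc_unimodular {g : ℕ → ℂ} (hg : ∀ n, ‖g n‖ ≤ 1) {β : ℂ} (hβ : β.re = 0) (y : ℕ) :
    Dom (fun n => if n < y then g n * (n : ℂ) ^ (-β) else 0) 1 (smoothIndLE y) := by
  refine dom_smoothIndLE_of_support zero_le_one (fun n hn => ?_) (fun n hn => ?_)
  · show ‖(if n < y then g n * (n : ℂ) ^ (-β) else 0)‖ ≤ 1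
    by_cases h : n < y
    · rw [if_pos h, norm_mul, norm_natCast_cpow_neg_of_re_zero hn hβ, mul_one]; exact hg n
    · rw [if_neg h, norm_zero]; exact zero_le_one
  · show (if n < y then g n * (n : ℂ) ^ (-β) else 0) = 0
    exact if_neg (not_lt.mpr hn.le)

/-- **(15.2) as a domination**: the coefficients `b(n)χ(n)` of `B(s,ψ)` as a polynomial in `ψ` satisfy
`bχ ≪ β·τ₂`, `β = (1+|ι₂|)(|ι₃|+|ι₄|)` (tree `Skeleton.norm_bcoef_le`; `|χ(n)| ≤ 1`), for `𝓛 ≥ 2`.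
[cite: Zhang2022LandauSiegel, §15 (15.2) p.79] -/
theorem dom_bcoef_chi {D : ℕ} [NeZero D] (χ : DirichletCharacter ℂ D) (hD : 2 ≤ Real.log D) :
    Dom (fun n => bcoef D n * χ (n : ZMod D)) ((1 + ‖iota2‖) * (‖iota3‖ + ‖iota4‖)) (tau 2) := by
  intro n _
  rw [norm_mul]
  calc ‖bcoef D n‖ * ‖χ (n : ZMod D)‖ ≤ ‖bcoef D n‖ * 1 :=
        mul_le_mul_of_nonneg_left (DirichletCharacter.norm_le_one χ _) (norm_nonneg _)
    _ ≤ (1 + ‖iota2‖) * (‖iota3‖ + ‖iota4‖) * tau 2 n := by rw [mul_one]; exact norm_bcoef_le hD n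

/-- A truncation of a dominated sequence is dominated by the same block (`G ≥ 0`).
[cite: Zhang2022LandauSiegel, §15 (15.2) p.79] -/
theorem dom_trunc_of_dom {u : ℕ → ℂ} {C : ℝ} {G : ArithmeticFunction ℝ} (hu : Dom u C G)
    (hC : 0 ≤ C) (hG : ∀ n, 0 ≤ G n) (N : ℕ) :
    Dom (fun n => if n < N then u n else 0) C G := by
  intro n hn
  show ‖(if n < N then u n else 0)‖ ≤ C * G n
  by_cases h : n < N
  · rw [if_pos h]; exact hu n hn
  · rw [if_neg h, norm_zero]; exact mul_nonneg hC (hG n)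

/-! ## The logarithmic mean squares of the coefficients -/

/-- The block of `(short)·B`: `smoothIndLE y ∗ τ₂` (degree `3`), with prime values `[p ≤ y] + 2`.
[cite: Zhang2022LandauSiegel, §15 (15.2); §6 Lemma 6.1] -/
theorem isBlock_smoothIndLE_mul_tau_two (y : ℕ) :
    IsBlock (smoothIndLE y * tau 2) 3 ∧
      ∀ p, p.Prime → (smoothIndLE y * tau 2) p = cutInd y p + 2 := by
  refine ⟨?_, fun p hp => ?_⟩
  · have h := (isBlock_smoothIndLE y).mul (isBlock_tau 2)
    simpa using h
  · rw [(isBlock_smoothIndLE y).mul_prime (isBlock_tau 2) hp, smoothIndLE_prime hp, tau_prime 2 hp]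
    norm_num

/-- **Coefficients of `(short factor)·B`**: if `u ≪ U·smoothIndLE y` (`U ≥ 0`, `y ≥ 2`) and
`b ≪ β·τ₂`, then for `X ≥ 2`, `Σ_{k≤X} |(u⋆b)(k)|²/k ≤ (Uβ)²·majorantConst 9 6·(log X)⁴(log y)⁵`
(prime values `([p≤y] + 2)² = 4 + 5[p≤y]`; a factor supported on `n ≤ y` costs `log y`, not `log X`).
[cite: Zhang2022LandauSiegel, §13 p.75; §15 (15.2) p.79] -/
theorem sum_norm_seqConv_short_bcoef_sq_div_le {u b : ℕ → ℂ} {U β : ℝ} {y : ℕ}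
    (hu : Dom u U (smoothIndLE y)) (hb : Dom b β (tau 2)) (hy : 2 ≤ y) {X : ℕ} (hX : 2 ≤ X) :
    ∑ k ∈ Icc 1 X, ‖seqConv u b k‖ ^ 2 / k ≤
      (U * β) ^ 2 * (majorantConst 9 6 * (Real.log X ^ 4 * Real.log y ^ 5)) := by
  obtain ⟨hblock, hprime⟩ := isBlock_smoothIndLE_mul_tau_two y
  have hdom : Dom (seqConv u b) (U * β) (smoothIndLE y * tau 2) := dom_seqConv hu hb
  have hGp : ∀ p, p.Prime → (smoothIndLE y * tau 2) p ^ 2 ≤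
      ((4 : ℕ) : ℝ) + ((5 : ℕ) : ℝ) * cutInd y p + ((0 : ℕ) : ℝ) * cutInd 2 p +
        ((0 : ℕ) : ℝ) * (cutInd 0 p * (fun _ : ℕ => (0 : ℝ)) p) + 0 * Real.log p := by
    intro p hp
    rw [hprime p hp]
    rcases cutInd_zero_or_one y p with h | h <;> rw [h] <;> norm_num
  have key := sum_norm_sq_div_le_of_dom hdom hblock le_rfl hy le_rfl hGp hX
  refine key.trans (le_of_eq ?_)
  rw [scaleBound]
  norm_num

/-- **Coefficients of `(short)·(short)`** (e.g. `N(s+β₂,ψ)N(s+β₃,ψ)`, length `4T⁴`): if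
`u, v ≪ 1·smoothIndLE y` (`y ≥ 2`), then for `X ≥ 2`, `Σ_{k≤X} |(u⋆v)(k)|²/k ≤ majorantConst 4 2·(log y)⁴`
(independent of `X`). [cite: Zhang2022LandauSiegel, §13 p.75; §6 Lemma 6.1 p.30] -/
theorem sum_norm_seqConv_short_short_sq_div_le {u v : ℕ → ℂ} {y : ℕ}
    (hu : Dom u 1 (smoothIndLE y)) (hv : Dom v 1 (smoothIndLE y)) (hy : 2 ≤ y) {X : ℕ} (hX : 2 ≤ X) :
    ∑ k ∈ Icc 1 X, ‖seqConv u v k‖ ^ 2 / k ≤ majorantConst 4 2 * Real.log y ^ 4 := by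
  have hblock : IsBlock (smoothIndLE y * smoothIndLE y) 1 := by
    simpa using (isBlock_smoothIndLE y).mul (isBlock_smoothIndLE y)
  have hdom : Dom (seqConv u v) (1 * 1) (smoothIndLE y * smoothIndLE y) := dom_seqConv hu hv
  have hGp : ∀ p, p.Prime → (smoothIndLE y * smoothIndLE y) p ^ 2 ≤
      ((0 : ℕ) : ℝ) + ((4 : ℕ) : ℝ) * cutInd y p + ((0 : ℕ) : ℝ) * cutInd 2 p +
        ((0 : ℕ) : ℝ) * (cutInd 0 p * (fun _ : ℕ => (0 : ℝ)) p) + 0 * Real.log p := by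
    intro p hp
    rw [(isBlock_smoothIndLE y).mul_prime (isBlock_smoothIndLE y) hp, smoothIndLE_prime hp]
    rcases cutInd_zero_or_one y p with h | h <;> rw [h] <;> norm_num
  have key := sum_norm_sq_div_le_of_dom hdom hblock le_rfl hy le_rfl hGp hX
  refine key.trans (le_of_eq ?_)
  rw [scaleBound]
  norm_num

/-- **Coefficients of `B` alone**: `b ≪ β·τ₂` ⇒ `Σ_{k≤X} |b(k)|²/k ≤ β²·majorantConst 4 4·(log X)⁴`
(`X ≥ 2`; the printed count `Σ_{n≤X} τ₂(n)²/n ≪ (log X)⁴`, tree `sum_tau_sq_div_le`).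
[cite: Zhang2022LandauSiegel, §13 p.75; §15 (15.2) p.79] -/
theorem sum_norm_sq_div_le_of_dom_tau_two {b : ℕ → ℂ} {β : ℝ} (hb : Dom b β (tau 2))
    {X : ℕ} (hX : 2 ≤ X) :
    ∑ k ∈ Icc 1 X, ‖b k‖ ^ 2 / k ≤ β ^ 2 * (majorantConst 4 4 * Real.log X ^ 4) :=
  (sum_norm_sq_div_le_of_le hb X).trans (mul_le_mul_of_nonneg_left (sum_tau_sq_div_le 2 hX) (sq_nonneg _))

/-- **Coefficients of a single short factor** (`K`, `N`, the `E₁`-polynomial: `|c(n)| ≤ 1` on `n < y`):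
`Σ_{k≤X} |c(k)|²/k ≤ 1 + log X` for `X ≥ 1`… here in the form `Σ_{k≤X}|c(k)|²/k ≤ Σ_{k≤X} 1/k ≤ 1 + log X`.
[cite: Zhang2022LandauSiegel, §6 Lemma 6.1 p.30; §13 p.75] -/
theorem sum_norm_sq_div_le_one_add_log {c : ℕ → ℂ} (hc : ∀ n, ‖c n‖ ≤ 1) (X : ℕ) :
    ∑ k ∈ Icc 1 X, ‖c k‖ ^ 2 / k ≤ 1 + Real.log X := by
  have h1 : ∑ k ∈ Icc 1 X, ‖c k‖ ^ 2 / k ≤ ∑ k ∈ Icc 1 X, (k : ℝ)⁻¹ := by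
    refine Finset.sum_le_sum fun k hk => ?_
    have hk0 : (0 : ℝ) < k := by exact_mod_cast (Finset.mem_Icc.mp hk).1
    rw [div_eq_mul_inv]
    calc ‖c k‖ ^ 2 * (k : ℝ)⁻¹ ≤ 1 * (k : ℝ)⁻¹ := by
          refine mul_le_mul_of_nonneg_right ?_ (inv_nonneg.mpr hk0.le)
          calc ‖c k‖ ^ 2 ≤ 1 ^ 2 := pow_le_pow_left₀ (norm_nonneg _) (hc k) 2
            _ = 1 := one_pow 2
      _ = (k : ℝ)⁻¹ := one_mul _
  refine h1.trans ?_
  have h := harmonic_le_one_add_log X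
  rw [harmonic_eq_sum_Icc] at h
  push_cast at h
  exact h

end Literature.NumberTheory.LFunctions.Zhang2022.Typed.Section13
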